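import Summits.QuantumFields.YangMills.Theorems.VirialFluxGapAssemblyPointPackage
import Summits.QuantumFields.YangMills.Theorems.VirialFluxGapRegularityCutoffDerivative
import HarnessLib

/-!
# Route `VirialFluxGap` (YangMills): ASSEMBLY OF THE PATCHED EULER FIELD ON `X_fix`, PART III — the two POINT PACKAGES in the letters of
# the patching: the GENERIC COLLAR PACKAGE (keyed on `ρ²/2 ≤ some mass`, `F ≤ t₀`) and the CENTRAL WINDOW PACKAGE (keyed on `all masses ≤ ρ²`)

Toward the deciding crux `VirialFluxGap.PeriodicSoftness` (item stmt-QuantumFields-24141).  Part IV (`…AssemblyOfCentralField`) patches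
`c¹ = 2·resolventCoeff fixFrameStd λ⋆ θ` (det-localised resolvent field) with the central coefficients `C` through w2's ✓`regCutoff ρ`; at a point
of `X_fix` the budgets ✓`pos_budget` ∕ ✓`drive_budget` ∕ ✓`div_budget` ask for CONDITIONAL facts.  This file states them in final form:

* `mass_of_regCutoff_ne_zero` ∕ `mass_of_regCutoff_ne_one` — bridges from the cut-off values to the mass conditions (w2's
  ✓`regular_of_regCutoff_ne_zero` ∕ ✓`central_of_regCutoff_ne_one`, weakened to `≤`);
* ★★ `generic_collar_package` — at `x` with `ρ²/2 ≤` some regularity mass and `F_fix x ≤ t₀` (`t₀ ≤ t_G`, floor `2δ′ ≤ det²` on the window):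
  `θ(M_x) = 1`, `0 ≤ gᵀA⁻¹g`, `(1−ε)F ≤ ½gᵀA⁻¹g`, `Σ_va ∂_va c¹_va ≤ #ι − 4 + 1/4`, `c¹_va(M_x) = (A⁻¹g)_va`, and along each of the four masses
  `Σ_va (A⁻¹g)_va·∂_va m ≤ A_G·√t₀` with `A_G = √(#ι·2C₂L⁴/(λ⋆/2)²)·√(4#ι)` (✓`generic_point_package`, Cauchy–Schwarz, w2's ✓`abs_frameD_linkMass_le`);
* ★ `central_window_package` — the central hypotheses (P2)–(P4) read at `x` with all masses `≤ ρ²` and `F_fix x ≤ t₀ ≤ t_C`, with `ε_C ≤ ε`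
  and `√F ≤ √t₀` already applied.

HONEST LABEL: helpers; no field is assembled in THIS file; ⟨24141⟩, ⟨22884⟩ remain OPEN; the Yang–Mills mass gap is NOT proved; no summit is
proved by a line.  THEOREMS ONLY (0 `def`, 0 `sorry`), standard axioms.  Explicit-unit seat `ym-line-fcl-p3` g41 (cell ym-idea-1, free hands),
`--supports stmt-QuantumFields-24141`.  References: [cite: Luscher1983, §2]; [folklore].
-/

set_option autoImplicit false

noncomputable section

open scoped Matrix BigOperators ContDiff Topology Quaternion
open MeasureTheory Set Matrix
open Literature.MathematicalPhysics.QuantumFieldTheory hiding SU2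
open Literature.MathematicalPhysics.QuantumLattice
open Literature.MathematicalPhysics.QuantumFieldTheory.SUNBakryEmery (expSU coe_expSU matTop)

namespace Summit.QuantumFields.YangMills.Theorems.VirialFluxGap.FrameHessian

open Summit.QuantumFields.YangMills.Theorems.FemtoTransferGap
open Summit.QuantumFields.YangMills.Theorems.FemtoTransferGap.TT
open Summit.QuantumFields.YangMills.Theorems.FemtoTransferGap.TwoLattice
open Summit.QuantumFields.YangMills.Theorems.FemtoTransferGap.TwoLattice.Flat
open Summit.QuantumFields.YangMills.Theorems.VirialFluxGap.RingDeficit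
open Summit.QuantumFields.YangMills.Theorems.VirialFluxGap.FrameDerivative
open Summit.QuantumFields.YangMills.Theorems.VirialFluxGap.ResolventField
open Summit.QuantumFields.YangMills.Theorems.VirialFluxGap.RegularValley
open Summit.QuantumFields.YangMills.Theorems.VirialFluxGap.FixFrame
open Summit.QuantumFields.YangMills.Theorems.VirialFluxGap.RegCutoff

variable {L : ℕ} [NeZero L]

open scoped Matrix.Norms.Frobenius

/-! ## §1 Bridges from the cut-off values to the mass conditions -/

omit [NeZero L] in
/-- Where `χ_reg ≠ 0`, some regularity mass is `≥ ρ²/2`. [folklore] -/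
theorem mass_of_regCutoff_ne_zero {ρ : ℝ} (hρ : 0 < ρ)
    {M : (Fin (2 * L - 1 + 1) → Edge 3 L → Matrix (Fin 2) (Fin 2) ℂ) × (Site 3 L → Matrix (Fin 2) (Fin 2) ℂ)} (h : regCutoff ρ M ≠ 0) :
    (∃ k : Fin 3, ρ ^ 2 / 2 ≤ linkMass k M) ∨ ρ ^ 2 / 2 ≤ seamMass M := by
  rcases regular_of_regCutoff_ne_zero hρ h with ⟨k, hk⟩ | hs
  · exact Or.inl ⟨k, hk.le⟩
  · exact Or.inr hs.le

omit [NeZero L] in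
/-- Where `χ_reg ≠ 1`, every regularity mass is `≤ ρ²`. [folklore] -/
theorem mass_of_regCutoff_ne_one {ρ : ℝ} (hρ : 0 < ρ)
    {M : (Fin (2 * L - 1 + 1) → Edge 3 L → Matrix (Fin 2) (Fin 2) ℂ) × (Site 3 L → Matrix (Fin 2) (Fin 2) ℂ)} (h : regCutoff ρ M ≠ 1) :
    (∀ k : Fin 3, linkMass k M ≤ ρ ^ 2) ∧ seamMass M ≤ ρ ^ 2 := by
  obtain ⟨hk, hs⟩ := central_of_regCutoff_ne_one hρ h
  exact ⟨fun k => (hk k).le, hs.le⟩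

omit [NeZero L] in
/-- In the collar (neither the core nor the strict regular region) both mass conditions hold. [folklore] -/
theorem collar_masses {ρ : ℝ}
    {M : (Fin (2 * L - 1 + 1) → Edge 3 L → Matrix (Fin 2) (Fin 2) ℂ) × (Site 3 L → Matrix (Fin 2) (Fin 2) ℂ)}
    (hcore : ¬ ((∀ k : Fin 3, linkMass k M < ρ ^ 2 / 2) ∧ seamMass M < ρ ^ 2 / 2))
    (hreg : ¬ ((∃ k : Fin 3, ρ ^ 2 < linkMass k M) ∨ ρ ^ 2 < seamMass M)) :
    ((∃ k : Fin 3, ρ ^ 2 / 2 ≤ linkMass k M) ∨ ρ ^ 2 / 2 ≤ seamMass M) ∧ ((∀ k : Fin 3, linkMass k M ≤ ρ ^ 2) ∧ seamMass M ≤ ρ ^ 2) := by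
  constructor
  · by_contra hcon
    push Not at hcon
    exact hcore ⟨fun k => hcon.1 k, hcon.2⟩
  · by_contra hcon
    apply hreg
    by_cases hs : seamMass M ≤ ρ ^ 2
    · left
      by_contra hk
      push Not at hk
      exact hcon ⟨fun k => hk k, hs⟩
    · exact Or.inr (lt_of_not_ge hs)

/-! ## §2 The generic collar package -/

/-- ★★ **The generic collar package.**  `ρ ∈ (0,1]`, `ρ′ = ρ/√2`; `K ≥ 0`, `ε ∈ (0,1]`, the trilinear bound; the gradient–energy constant `C₂`;
a window `t₀ ≤ t_G` and a floor `2δ′ ≤ det(H+λ⋆1)²` on the closed generic window.  At a point `x` with `ρ²/2 ≤` some regularity mass and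
`F_fix x ≤ t₀`: `θ = 1`; `0 ≤ gᵀA⁻¹g`; `(1−ε)F ≤ ½gᵀA⁻¹g`; `div c¹ ≤ #ι − 4 + 1/4`; `c¹_va = (A⁻¹g)_va`; and along the four masses
`Σ_va (A⁻¹g)_va ∂_va m ≤ A_G·√t₀`. [cite: Luscher1983, §2] -/
theorem generic_collar_package [DecidableEq (FixVar L × Fin 3)] {ρ K ε t₀ δ' C₂ : ℝ} (hρ : 0 < ρ) (hρ1 : ρ ≤ 1) (hK : 0 ≤ K) (hε : 0 < ε) (hε1 : ε ≤ 1)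
    (hK3 : ∀ (Y₁ Y₂ Y₃ : ((Fin (2 * L - 1 + 1) × Edge 3 L) ⊕ Site 3 L) → Matrix (Fin 2) (Fin 2) ℂ) (b₁ b₂ b₃ : ℝ), 0 ≤ b₁ → 0 ≤ b₂ → 0 ≤ b₃ →
      (∀ w, ‖Y₁ w‖ ≤ b₁) → (∀ w, ‖Y₂ w‖ ≤ b₂) → (∀ w, ‖Y₃ w‖ ≤ b₃) → ∀ Q : ((Fin (2 * L - 1 + 1) → GaugeConfig 3 L SU2) × (Site 3 L → SU2)),
      |frameD Y₁ (frameD Y₂ (frameD Y₃ (ringPoly L))) (ringCoord L Q)| ≤ K * b₁ * b₂ * b₃)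
    (hC₂0 : 0 ≤ C₂)
    (hC₂ : ∀ (Q : ((Fin (2 * L - 1 + 1) → GaugeConfig 3 L SU2) × (Site 3 L → SU2)))
      (Y : ((Fin (2 * L - 1 + 1) × Edge 3 L) ⊕ Site 3 L) → Matrix (Fin 2) (Fin 2) ℂ), (∀ w, (Y w)ᴴ = -Y w) → (∀ w, (Y w).trace = 0) →
      ∀ b : ℝ, 0 ≤ b → (∀ w, ‖Y w‖ ≤ b) →
      (frameD Y (ringPoly L) (ringCoord L Q)) ^ 2 ≤ 2 * (C₂ * (L : ℝ) ^ 4 * b ^ 2) * ringDeficit L (fun _ => false) Q)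
    (ht₀G : t₀ ≤ (ρ / Real.sqrt 2) ^ 2 * ε ^ 3 * ((ρ / Real.sqrt 2) ^ 2 / (1032960 * (L : ℝ) ^ 8)) ^ 2 /
          (1032960 * 10000 * (L : ℝ) ^ 8 * (K + 1) ^ 2 * (Fintype.card (FixVar L × Fin 3) : ℝ) ^ 5))
    (hδ' : 0 < δ')
    (hδ : ∀ x : (OffIdx L → SU2) × ((Fin (2 * L - 1) → GaugeConfig 3 L SU2) × (Site 3 L → SU2)),
      ((∃ k : Fin 3, (ρ / Real.sqrt 2) ^ 2 ≤ 1 - (su2Quat (wrapReps ((Fin.cons (glue x.1) x.2.1 : Fin (2 * L - 1 + 1) → GaugeConfig 3 L SU2) 0) k)).re ^ 2) ∨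
          (ρ / Real.sqrt 2) ^ 2 ≤ 1 - (su2Quat (x.2.2 0)).re ^ 2) →
      ringDeficit L (fun _ => false) ((Fin.cons (glue x.1) x.2.1 : Fin (2 * L - 1 + 1) → GaugeConfig 3 L SU2), x.2.2) ≤
        (ρ / Real.sqrt 2) ^ 2 * ε ^ 3 * ((ρ / Real.sqrt 2) ^ 2 / (1032960 * (L : ℝ) ^ 8)) ^ 2 /
          (1032960 * 10000 * (L : ℝ) ^ 8 * (K + 1) ^ 2 * (Fintype.card (FixVar L × Fin 3) : ℝ) ^ 5) →
      2 * δ' ≤ ((frameHess (L := L) fixFrameStd (ringCoord L ((Fin.cons (glue x.1) x.2.1 : Fin (2 * L - 1 + 1) → GaugeConfig 3 L SU2), x.2.2)) +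
        (ε * ((ρ / Real.sqrt 2) ^ 2 / (1032960 * (L : ℝ) ^ 8)) / 3) • (1 : Matrix (FixVar L × Fin 3) (FixVar L × Fin 3) ℝ)).det) ^ 2)
    (x : (OffIdx L → SU2) × ((Fin (2 * L - 1) → GaugeConfig 3 L SU2) × (Site 3 L → SU2)))
    (hmass : (∃ k : Fin 3, ρ ^ 2 / 2 ≤ linkMass k (ringCoord L ((Fin.cons (glue x.1) x.2.1 : Fin (2 * L - 1 + 1) → GaugeConfig 3 L SU2), x.2.2))) ∨
        ρ ^ 2 / 2 ≤ seamMass (ringCoord L ((Fin.cons (glue x.1) x.2.1 : Fin (2 * L - 1 + 1) → GaugeConfig 3 L SU2), x.2.2)))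
    (hF : ringDeficit L (fun _ => false) ((Fin.cons (glue x.1) x.2.1 : Fin (2 * L - 1 + 1) → GaugeConfig 3 L SU2), x.2.2) ≤ t₀) :
    (1 - deficitStep (((frameHess (L := L) fixFrameStd (ringCoord L ((Fin.cons (glue x.1) x.2.1 : Fin (2 * L - 1 + 1) → GaugeConfig 3 L SU2), x.2.2)) +
        (ε * ((ρ / Real.sqrt 2) ^ 2 / (1032960 * (L : ℝ) ^ 8)) / 3) • (1 : Matrix (FixVar L × Fin 3) (FixVar L × Fin 3) ℝ)).det) ^ 2 / δ') = 1) ∧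
    0 ≤ frameGrad (L := L) fixFrameStd (ringCoord L ((Fin.cons (glue x.1) x.2.1 : Fin (2 * L - 1 + 1) → GaugeConfig 3 L SU2), x.2.2)) ⬝ᵥ
        ((frameHess (L := L) fixFrameStd (ringCoord L ((Fin.cons (glue x.1) x.2.1 : Fin (2 * L - 1 + 1) → GaugeConfig 3 L SU2), x.2.2)) +
          (ε * ((ρ / Real.sqrt 2) ^ 2 / (1032960 * (L : ℝ) ^ 8)) / 3) • (1 : Matrix (FixVar L × Fin 3) (FixVar L × Fin 3) ℝ))⁻¹ *ᵥ
          frameGrad (L := L) fixFrameStd (ringCoord L ((Fin.cons (glue x.1) x.2.1 : Fin (2 * L - 1 + 1) → GaugeConfig 3 L SU2), x.2.2))) ∧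
    (1 - ε) * ringDeficit L (fun _ => false) ((Fin.cons (glue x.1) x.2.1 : Fin (2 * L - 1 + 1) → GaugeConfig 3 L SU2), x.2.2) ≤
      (1 / 2) * (frameGrad (L := L) fixFrameStd (ringCoord L ((Fin.cons (glue x.1) x.2.1 : Fin (2 * L - 1 + 1) → GaugeConfig 3 L SU2), x.2.2)) ⬝ᵥ
        ((frameHess (L := L) fixFrameStd (ringCoord L ((Fin.cons (glue x.1) x.2.1 : Fin (2 * L - 1 + 1) → GaugeConfig 3 L SU2), x.2.2)) +
          (ε * ((ρ / Real.sqrt 2) ^ 2 / (1032960 * (L : ℝ) ^ 8)) / 3) • (1 : Matrix (FixVar L × Fin 3) (FixVar L × Fin 3) ℝ))⁻¹ *ᵥ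
          frameGrad (L := L) fixFrameStd (ringCoord L ((Fin.cons (glue x.1) x.2.1 : Fin (2 * L - 1 + 1) → GaugeConfig 3 L SU2), x.2.2)))) ∧
    (∑ va : FixVar L × Fin 3, frameD (fixFrameStd va)
        (fun M' : (Fin (2 * L - 1 + 1) → Edge 3 L → Matrix (Fin 2) (Fin 2) ℂ) × (Site 3 L → Matrix (Fin 2) (Fin 2) ℂ) =>
          2 * resolventCoeff (L := L) fixFrameStd ((ε * ((ρ / Real.sqrt 2) ^ 2 / (1032960 * (L : ℝ) ^ 8)) / 3))
            (fun M'' : (Fin (2 * L - 1 + 1) → Edge 3 L → Matrix (Fin 2) (Fin 2) ℂ) × (Site 3 L → Matrix (Fin 2) (Fin 2) ℂ) =>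
              1 - deficitStep (((frameHess (L := L) fixFrameStd M'' +
                (ε * ((ρ / Real.sqrt 2) ^ 2 / (1032960 * (L : ℝ) ^ 8)) / 3) • (1 : Matrix (FixVar L × Fin 3) (FixVar L × Fin 3) ℝ)).det) ^ 2 / δ')) va M')
        (ringCoord L ((Fin.cons (glue x.1) x.2.1 : Fin (2 * L - 1 + 1) → GaugeConfig 3 L SU2), x.2.2)) ≤
      (Fintype.card (FixVar L × Fin 3) : ℝ) - 4 + 1 / 4) ∧
    (∀ va : FixVar L × Fin 3,
      2 * resolventCoeff (L := L) fixFrameStd ((ε * ((ρ / Real.sqrt 2) ^ 2 / (1032960 * (L : ℝ) ^ 8)) / 3))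
            (fun M'' : (Fin (2 * L - 1 + 1) → Edge 3 L → Matrix (Fin 2) (Fin 2) ℂ) × (Site 3 L → Matrix (Fin 2) (Fin 2) ℂ) =>
              1 - deficitStep (((frameHess (L := L) fixFrameStd M'' +
                (ε * ((ρ / Real.sqrt 2) ^ 2 / (1032960 * (L : ℝ) ^ 8)) / 3) • (1 : Matrix (FixVar L × Fin 3) (FixVar L × Fin 3) ℝ)).det) ^ 2 / δ')) va
            (ringCoord L ((Fin.cons (glue x.1) x.2.1 : Fin (2 * L - 1 + 1) → GaugeConfig 3 L SU2), x.2.2)) =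
        ((frameHess (L := L) fixFrameStd (ringCoord L ((Fin.cons (glue x.1) x.2.1 : Fin (2 * L - 1 + 1) → GaugeConfig 3 L SU2), x.2.2)) +
          (ε * ((ρ / Real.sqrt 2) ^ 2 / (1032960 * (L : ℝ) ^ 8)) / 3) • (1 : Matrix (FixVar L × Fin 3) (FixVar L × Fin 3) ℝ))⁻¹ *ᵥ
          frameGrad (L := L) fixFrameStd (ringCoord L ((Fin.cons (glue x.1) x.2.1 : Fin (2 * L - 1 + 1) → GaugeConfig 3 L SU2), x.2.2))) va) ∧
    (∀ k : Fin 3, ∑ va : FixVar L × Fin 3,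
        ((frameHess (L := L) fixFrameStd (ringCoord L ((Fin.cons (glue x.1) x.2.1 : Fin (2 * L - 1 + 1) → GaugeConfig 3 L SU2), x.2.2)) +
          (ε * ((ρ / Real.sqrt 2) ^ 2 / (1032960 * (L : ℝ) ^ 8)) / 3) • (1 : Matrix (FixVar L × Fin 3) (FixVar L × Fin 3) ℝ))⁻¹ *ᵥ
          frameGrad (L := L) fixFrameStd (ringCoord L ((Fin.cons (glue x.1) x.2.1 : Fin (2 * L - 1 + 1) → GaugeConfig 3 L SU2), x.2.2))) va *
        frameD (fixFrameStd va) (linkMass k) (ringCoord L ((Fin.cons (glue x.1) x.2.1 : Fin (2 * L - 1 + 1) → GaugeConfig 3 L SU2), x.2.2)) ≤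
      (Real.sqrt ((Fintype.card (FixVar L × Fin 3) : ℝ) * (2 * (C₂ * (L : ℝ) ^ 4)) /
          ((ε * ((ρ / Real.sqrt 2) ^ 2 / (1032960 * (L : ℝ) ^ 8)) / 3) / 2) ^ 2) * Real.sqrt (4 * (Fintype.card (FixVar L × Fin 3) : ℝ))) *
        Real.sqrt t₀) ∧
    ∑ va : FixVar L × Fin 3,
        ((frameHess (L := L) fixFrameStd (ringCoord L ((Fin.cons (glue x.1) x.2.1 : Fin (2 * L - 1 + 1) → GaugeConfig 3 L SU2), x.2.2)) +
          (ε * ((ρ / Real.sqrt 2) ^ 2 / (1032960 * (L : ℝ) ^ 8)) / 3) • (1 : Matrix (FixVar L × Fin 3) (FixVar L × Fin 3) ℝ))⁻¹ *ᵥ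
          frameGrad (L := L) fixFrameStd (ringCoord L ((Fin.cons (glue x.1) x.2.1 : Fin (2 * L - 1 + 1) → GaugeConfig 3 L SU2), x.2.2))) va *
        frameD (fixFrameStd va) seamMass (ringCoord L ((Fin.cons (glue x.1) x.2.1 : Fin (2 * L - 1 + 1) → GaugeConfig 3 L SU2), x.2.2)) ≤
      (Real.sqrt ((Fintype.card (FixVar L × Fin 3) : ℝ) * (2 * (C₂ * (L : ℝ) ^ 4)) /
          ((ε * ((ρ / Real.sqrt 2) ^ 2 / (1032960 * (L : ℝ) ^ 8)) / 3) / 2) ^ 2) * Real.sqrt (4 * (Fintype.card (FixVar L × Fin 3) : ℝ))) *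
        Real.sqrt t₀ := by
  have hρ'sq : (ρ / Real.sqrt 2) ^ 2 = ρ ^ 2 / 2 := by rw [div_pow, Real.sq_sqrt (by norm_num)]
  have hρ'0 : 0 < ρ / Real.sqrt 2 := by positivity
  have hρ'1 : ρ / Real.sqrt 2 ≤ 1 := by
    have h2 : (1 : ℝ) ≤ Real.sqrt 2 := by
      rw [show (1 : ℝ) = Real.sqrt 1 from Real.sqrt_one.symm]; exact Real.sqrt_le_sqrt (by norm_num)
    rw [div_le_one (by positivity)]; linarith only [hρ1, h2]
  have hreg : (∃ k : Fin 3, (ρ / Real.sqrt 2) ^ 2 ≤ 1 - (su2Quat (wrapReps ((Fin.cons (glue x.1) x.2.1 : Fin (2 * L - 1 + 1) → GaugeConfig 3 L SU2) 0) k)).re ^ 2) ∨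
      (ρ / Real.sqrt 2) ^ 2 ≤ 1 - (su2Quat (x.2.2 0)).re ^ 2 := by
    rcases hmass with ⟨k, hk⟩ | hs'
    · exact Or.inl ⟨k, by rw [hρ'sq, ← linkMass_fixEmbed]; exact hk⟩
    · exact Or.inr (by rw [hρ'sq, ← seamMass_fixEmbed]; exact hs')
  obtain ⟨hθ1, hθD, hnn, hdr, hdiv, hrr⟩ :=
    generic_point_package (L := L) hρ'0 hρ'1 hK hε hε1 hK3 hC₂0 hC₂ ht₀G hδ' hδ x hreg hF
  have hL0 : (0 : ℝ) < L := by exact_mod_cast NeZero.pos L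
  -- factor `√(X·t₀/D) = √(X/D)·√t₀`
  have hX0 : 0 ≤ (Fintype.card (FixVar L × Fin 3) : ℝ) * (2 * (C₂ * (L : ℝ) ^ 4)) /
      ((ε * ((ρ / Real.sqrt 2) ^ 2 / (1032960 * (L : ℝ) ^ 8)) / 3) / 2) ^ 2 := by positivity
  have hsplit : Real.sqrt ((Fintype.card (FixVar L × Fin 3) : ℝ) * (2 * (C₂ * (L : ℝ) ^ 4)) * t₀ /
        ((ε * ((ρ / Real.sqrt 2) ^ 2 / (1032960 * (L : ℝ) ^ 8)) / 3) / 2) ^ 2) =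
      Real.sqrt ((Fintype.card (FixVar L × Fin 3) : ℝ) * (2 * (C₂ * (L : ℝ) ^ 4)) /
        ((ε * ((ρ / Real.sqrt 2) ^ 2 / (1032960 * (L : ℝ) ^ 8)) / 3) / 2) ^ 2) * Real.sqrt t₀ := by
    rw [← Real.sqrt_mul hX0, div_mul_eq_mul_div, mul_right_comm]
  have hmassBound : ∀ d : FixVar L × Fin 3 → ℝ, (∀ va, |d va| ≤ 2) →
      ∑ va : FixVar L × Fin 3,
        ((frameHess (L := L) fixFrameStd (ringCoord L ((Fin.cons (glue x.1) x.2.1 : Fin (2 * L - 1 + 1) → GaugeConfig 3 L SU2), x.2.2)) +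
          (ε * ((ρ / Real.sqrt 2) ^ 2 / (1032960 * (L : ℝ) ^ 8)) / 3) • (1 : Matrix (FixVar L × Fin 3) (FixVar L × Fin 3) ℝ))⁻¹ *ᵥ
          frameGrad (L := L) fixFrameStd (ringCoord L ((Fin.cons (glue x.1) x.2.1 : Fin (2 * L - 1 + 1) → GaugeConfig 3 L SU2), x.2.2))) va * d va ≤
      (Real.sqrt ((Fintype.card (FixVar L × Fin 3) : ℝ) * (2 * (C₂ * (L : ℝ) ^ 4)) /
          ((ε * ((ρ / Real.sqrt 2) ^ 2 / (1032960 * (L : ℝ) ^ 8)) / 3) / 2) ^ 2) * Real.sqrt (4 * (Fintype.card (FixVar L × Fin 3) : ℝ))) *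
        Real.sqrt t₀ := by
    intro d hd
    refine (le_abs_self _).trans ((abs_sum_mul_le_sqrt_mul_sqrt _ _ hrr (sum_sq_le_of_abs_le_two d hd)).trans (le_of_eq ?_))
    rw [hsplit]; ring
  refine ⟨hθ1, hnn, hdr, hdiv, fun va => ?_, fun k => hmassBound _ fun va => abs_frameD_linkMass_le k (norm_fixFrameStd_le va) _,
    hmassBound _ fun va => abs_frameD_seamMass_le (norm_fixFrameStd_le va) _⟩
  rw [two_mul_resolventCoeff, hθ1, one_mul]

/-! ## §3 The central window package -/

/-- ★ **The central window package at a point**: the hypotheses (P2)–(P4) of the central field, read at a point with all four masses `≤ ρ²`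
and `F_fix x ≤ t₀ ≤ t_C`, with `ε_C ≤ ε ≤ 1` and `√F ≤ √t₀` applied. [folklore] -/
theorem central_window_package {ρ t_C t₀ N ε ε_C : ℝ}
    {C : FixVar L × Fin 3 → ((Fin (2 * L - 1 + 1) → Edge 3 L → Matrix (Fin 2) (Fin 2) ℂ) × (Site 3 L → Matrix (Fin 2) (Fin 2) ℂ)) → ℝ}
    (ht₀C : t₀ ≤ t_C) (hN0 : 0 ≤ N) (hεCε : ε_C ≤ ε) (hε1 : ε ≤ 1)
    (hP : ∀ x : (OffIdx L → SU2) × ((Fin (2 * L - 1) → GaugeConfig 3 L SU2) × (Site 3 L → SU2)),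
      (∀ k : Fin 3, 1 - (su2Quat (wrapReps ((Fin.cons (glue x.1) x.2.1 : Fin (2 * L - 1 + 1) → GaugeConfig 3 L SU2) 0) k)).re ^ 2 ≤ ρ ^ 2) →
      1 - (su2Quat (x.2.2 0)).re ^ 2 ≤ ρ ^ 2 →
      ringDeficit L (fun _ => false) ((Fin.cons (glue x.1) x.2.1 : Fin (2 * L - 1 + 1) → GaugeConfig 3 L SU2), x.2.2) ≤ t_C →
      2 * (1 - ε_C) * ringDeficit L (fun _ => false) ((Fin.cons (glue x.1) x.2.1 : Fin (2 * L - 1 + 1) → GaugeConfig 3 L SU2), x.2.2) ≤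
          ∑ va, C va (ringCoord L ((Fin.cons (glue x.1) x.2.1 : Fin (2 * L - 1 + 1) → GaugeConfig 3 L SU2), x.2.2)) *
            frameGrad (L := L) fixFrameStd (ringCoord L ((Fin.cons (glue x.1) x.2.1 : Fin (2 * L - 1 + 1) → GaugeConfig 3 L SU2), x.2.2)) va ∧
        ∑ va, frameD (fixFrameStd va) (C va) (ringCoord L ((Fin.cons (glue x.1) x.2.1 : Fin (2 * L - 1 + 1) → GaugeConfig 3 L SU2), x.2.2)) ≤
          18 * (L : ℝ) ^ 4 - 1 / 2 ∧
        (∀ k : Fin 3, -(N * Real.sqrt (ringDeficit L (fun _ => false) ((Fin.cons (glue x.1) x.2.1 : Fin (2 * L - 1 + 1) → GaugeConfig 3 L SU2), x.2.2))) ≤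
          ∑ va, C va (ringCoord L ((Fin.cons (glue x.1) x.2.1 : Fin (2 * L - 1 + 1) → GaugeConfig 3 L SU2), x.2.2)) *
            frameD (fixFrameStd va) (linkMass k) (ringCoord L ((Fin.cons (glue x.1) x.2.1 : Fin (2 * L - 1 + 1) → GaugeConfig 3 L SU2), x.2.2))) ∧
        -(N * Real.sqrt (ringDeficit L (fun _ => false) ((Fin.cons (glue x.1) x.2.1 : Fin (2 * L - 1 + 1) → GaugeConfig 3 L SU2), x.2.2))) ≤
          ∑ va, C va (ringCoord L ((Fin.cons (glue x.1) x.2.1 : Fin (2 * L - 1 + 1) → GaugeConfig 3 L SU2), x.2.2)) *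
            frameD (fixFrameStd va) seamMass (ringCoord L ((Fin.cons (glue x.1) x.2.1 : Fin (2 * L - 1 + 1) → GaugeConfig 3 L SU2), x.2.2)))
    (x : (OffIdx L → SU2) × ((Fin (2 * L - 1) → GaugeConfig 3 L SU2) × (Site 3 L → SU2)))
    (hk : ∀ k : Fin 3, linkMass k (ringCoord L ((Fin.cons (glue x.1) x.2.1 : Fin (2 * L - 1 + 1) → GaugeConfig 3 L SU2), x.2.2)) ≤ ρ ^ 2)
    (hs : seamMass (ringCoord L ((Fin.cons (glue x.1) x.2.1 : Fin (2 * L - 1 + 1) → GaugeConfig 3 L SU2), x.2.2)) ≤ ρ ^ 2)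
    (hF : ringDeficit L (fun _ => false) ((Fin.cons (glue x.1) x.2.1 : Fin (2 * L - 1 + 1) → GaugeConfig 3 L SU2), x.2.2) ≤ t₀) :
    2 * (1 - ε) * ringDeficit L (fun _ => false) ((Fin.cons (glue x.1) x.2.1 : Fin (2 * L - 1 + 1) → GaugeConfig 3 L SU2), x.2.2) ≤
        ∑ va, C va (ringCoord L ((Fin.cons (glue x.1) x.2.1 : Fin (2 * L - 1 + 1) → GaugeConfig 3 L SU2), x.2.2)) *
          frameGrad (L := L) fixFrameStd (ringCoord L ((Fin.cons (glue x.1) x.2.1 : Fin (2 * L - 1 + 1) → GaugeConfig 3 L SU2), x.2.2)) va ∧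
    0 ≤ ∑ va, C va (ringCoord L ((Fin.cons (glue x.1) x.2.1 : Fin (2 * L - 1 + 1) → GaugeConfig 3 L SU2), x.2.2)) *
          frameGrad (L := L) fixFrameStd (ringCoord L ((Fin.cons (glue x.1) x.2.1 : Fin (2 * L - 1 + 1) → GaugeConfig 3 L SU2), x.2.2)) va ∧
    ∑ va, frameD (fixFrameStd va) (C va) (ringCoord L ((Fin.cons (glue x.1) x.2.1 : Fin (2 * L - 1 + 1) → GaugeConfig 3 L SU2), x.2.2)) ≤
        18 * (L : ℝ) ^ 4 - 1 / 2 ∧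
    (∀ k : Fin 3, -(N * Real.sqrt t₀) ≤
        ∑ va, C va (ringCoord L ((Fin.cons (glue x.1) x.2.1 : Fin (2 * L - 1 + 1) → GaugeConfig 3 L SU2), x.2.2)) *
          frameD (fixFrameStd va) (linkMass k) (ringCoord L ((Fin.cons (glue x.1) x.2.1 : Fin (2 * L - 1 + 1) → GaugeConfig 3 L SU2), x.2.2))) ∧
    -(N * Real.sqrt t₀) ≤
        ∑ va, C va (ringCoord L ((Fin.cons (glue x.1) x.2.1 : Fin (2 * L - 1 + 1) → GaugeConfig 3 L SU2), x.2.2)) *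
          frameD (fixFrameStd va) seamMass (ringCoord L ((Fin.cons (glue x.1) x.2.1 : Fin (2 * L - 1 + 1) → GaugeConfig 3 L SU2), x.2.2)) := by
  have hk' : ∀ k : Fin 3, 1 - (su2Quat (wrapReps ((Fin.cons (glue x.1) x.2.1 : Fin (2 * L - 1 + 1) → GaugeConfig 3 L SU2) 0) k)).re ^ 2 ≤ ρ ^ 2 :=
    fun k => by rw [← linkMass_fixEmbed]; exact hk k
  have hs' : 1 - (su2Quat (x.2.2 0)).re ^ 2 ≤ ρ ^ 2 := by rw [← seamMass_fixEmbed]; exact hs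
  obtain ⟨hdr, hdiv, hmk, hms⟩ := hP x hk' hs' (hF.trans ht₀C)
  have hF0 : 0 ≤ ringDeficit L (fun _ => false) ((Fin.cons (glue x.1) x.2.1 : Fin (2 * L - 1 + 1) → GaugeConfig 3 L SU2), x.2.2) :=
    ringDeficit_nonneg _ _
  have hεC1 : ε_C ≤ 1 := hεCε.trans hε1
  have hsq : Real.sqrt (ringDeficit L (fun _ => false) ((Fin.cons (glue x.1) x.2.1 : Fin (2 * L - 1 + 1) → GaugeConfig 3 L SU2), x.2.2)) ≤ Real.sqrt t₀ :=
    Real.sqrt_le_sqrt hF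
  have hNs : N * Real.sqrt (ringDeficit L (fun _ => false) ((Fin.cons (glue x.1) x.2.1 : Fin (2 * L - 1 + 1) → GaugeConfig 3 L SU2), x.2.2)) ≤ N * Real.sqrt t₀ :=
    mul_le_mul_of_nonneg_left hsq hN0
  refine ⟨?_, ?_, hdiv, fun k => (neg_le_neg hNs).trans (hmk k), (neg_le_neg hNs).trans hms⟩
  · have : 2 * (1 - ε) * ringDeficit L (fun _ => false) ((Fin.cons (glue x.1) x.2.1 : Fin (2 * L - 1 + 1) → GaugeConfig 3 L SU2), x.2.2) ≤
        2 * (1 - ε_C) * ringDeficit L (fun _ => false) ((Fin.cons (glue x.1) x.2.1 : Fin (2 * L - 1 + 1) → GaugeConfig 3 L SU2), x.2.2) :=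
      mul_le_mul_of_nonneg_right (by linarith only [hεCε]) hF0
    exact this.trans hdr
  · have : 0 ≤ 2 * (1 - ε_C) * ringDeficit L (fun _ => false) ((Fin.cons (glue x.1) x.2.1 : Fin (2 * L - 1 + 1) → GaugeConfig 3 L SU2), x.2.2) :=
      mul_nonneg (by linarith only [hεC1]) hF0
    exact this.trans hdr

end Summit.QuantumFields.YangMills.Theorems.VirialFluxGap.FrameHessian

end
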